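import Summits.AtomisticToContinuum.Crystallization.Theses.GappedShellCensus
import Summits.AtomisticToContinuum.Crystallization.Theses.PalmUnimodularRigidity
import Summits.AtomisticToContinuum.Crystallization.Theorems.PhononSlackCertificatesPeriodicGivenLayered

/-!
# Sketch — crux `GappedShellCensus.CleanLimitsHaveWindows` (stmt-AtomisticToContinuum-15932), ideator 2, round 1

First lemmas of the two idea cards (`prism-mean-ironing`, `clean-hull-palm`), typed over existing
declarations, plus the kernel-checked transfers that justify them:

* `HullOfCleanLimitIsLayered` (card A's transfer target C⁺) and
  `cleanLimitsHaveWindows_of_layered : HullOfCleanLimitIsLayered → CleanLimitsHaveWindows`,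
  proved sorry-free from the LANDED `LayeredHull.PeriodicGivenLayered_of` (stmt-11779).
* `RecurrentCleanHullElement` (card A, stub 2: a uniformly recurrent clean element of the hull of `Y`
  that is still window-matched by translates of the ground states) — statement only.
* `HullPalmLaw` (card B's first lemma: a minimising point-stationary hard-core law carried by clean
  hull elements, in the measure format of `PalmUnimodularRigidity.LayeredLawsSelectHcp`, stmt-9226) and
  `FunnelToTubeTwoPercent` (card B, stub 3) — statements only; the composition with 9226 is sketched
  as `cleanLimitsHaveWindows_of_palm` (sorried glue, elaborates).
-/

noncomputable section

namespace Summit.AtomisticToContinuum.Crystallization.Cruxes.CleanLimitsHaveWindows.IdeatorTwo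

open Filter MeasureTheory
open Literature.MathematicalPhysics.StatisticalMechanics Literature.Geometry.DiscreteGeometry

/-- `ℝ³`. -/
abbrev E3 := EuclideanSpace ℝ (Fin 3)

/-- The crux's cleanliness predicate at scale `a` (verbatim body of the hypothesis of
`CleanLimitsHaveWindows`): every site is gapped-twelve at `(a, 1/50, 63/50)` with its rescaled bond
shell `1/5`-close to the fcc or hcp kissing pattern. -/
def IsClean (a : ℝ) (Y : Set E3) : Prop :=
  ∀ y ∈ Y, ({w ∈ Y | w ≠ y ∧ dist y w ≤ a * (1 + 1 / 50)}.ncard = 12 ∧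
    ∀ w ∈ Y, w ≠ y → a * (1 - 1 / 50) ≤ dist y w ∧ (dist y w ≤ a * (1 + 1 / 50) ∨ a * (63 / 50) ≤ dist y w)) ∧
    ∃ T : Finset E3, (↑T : Set E3) = (fun w => a⁻¹ • (w - y)) '' {w ∈ Y | w ≠ y ∧ dist y w ≤ a * (1 + 1 / 50)} ∧
      (ShellCloseTo (1 / 5) T fccKissingPattern ∨ ShellCloseTo (1 / 5) T hcpKissingPattern)

/-- `Y` is a local limit of translates of a subsequence of `x` (verbatim clause of the crux). -/
def IsLocalLimit (x : (N : ℕ) → (Fin N → E3)) (Y : Set E3) : Prop :=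
  ∃ (φ : ℕ → ℕ) (t : ℕ → E3), StrictMono φ ∧ ∀ R ε : ℝ, 0 < ε → ∀ᶠ n in atTop,
    (∀ y ∈ Y, ‖y‖ ≤ R → ∃ i : Fin (φ n), dist (x (φ n) i + t n) y ≤ ε) ∧
    (∀ i : Fin (φ n), ‖x (φ n) i + t n‖ ≤ R → ∃ y ∈ Y, dist (x (φ n) i + t n) y ≤ ε)

/-- `S` lies in the hull of the sequence `x`: every ball of `S` is two-way `ε`-matched by a translate of
`x N`, frequently in `N` (the hull-membership shape consumed by the landed `stub_windowBounds` and by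
`PeriodicGivenLayered`). -/
def InHull (x : (N : ℕ) → (Fin N → E3)) (S : Set E3) : Prop :=
  ∀ R ε : ℝ, 0 < ε → ∃ᶠ N in atTop, ∃ t : E3,
    (∀ p ∈ S, ‖p‖ ≤ R → ∃ i : Fin N, dist (x N i + t) p ≤ ε) ∧
    (∀ i : Fin N, ‖x N i + t‖ ≤ R → ∃ p ∈ S, dist (x N i + t) p ≤ ε)

/-- The exactly layered set of `LayeredWindows` (stmt-11778) / `PeriodicGivenLayered` (stmt-11779):
rigid triangular layers of ONE spacing `a`, hole registry along the Hägg word `s`, free heights `z`,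
moved by the linear isometry `A`. -/
def layeredSet (a : ℝ) (A : E3 →ₗᵢ[ℝ] E3) (s : ℤ → ℤ) (z : ℤ → ℝ) : Set E3 :=
  {p | ∃ m i j : ℤ, p = A (((i : ℝ) • triangularVec₁ a) + ((j : ℝ) • triangularVec₂ a) +
    ((haggLabel s m : ℝ) • barlowOffset a) + (z m • layerNormal 1))}

/-! ## Card A — transfer target and its certified glue -/

/-- **C⁺ (card `prism-mean-ironing`): THE HULL OF A CLEAN LIMIT CONTAINS AN EXACTLY LAYERED SET.**
Under the hypotheses of the crux (LJ ground states `x`, clean local limit `Y ∋ 0` at scale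
`a ∈ [47/50, 1]`), some exactly layered set `layeredSet a' A s z` with `a' ∈ [47/50, 1]`, `IsHaggSeq s`
and heights increments in `[39a'/50, 17a'/20]` lies in the hull of `x`. -/
def HullOfCleanLimitIsLayered : Prop :=
  ∀ x : (N : ℕ) → (Fin N → E3), (∀ N, IsGroundState lennardJones (x N)) →
    ∀ (Y : Set E3) (a : ℝ), 47 / 50 ≤ a → a ≤ 1 → (0 : E3) ∈ Y → IsLocalLimit x Y → IsClean a Y →
      ∃ a' : ℝ, 47 / 50 ≤ a' ∧ a' ≤ 1 ∧ ∃ (A : E3 →ₗᵢ[ℝ] E3) (s : ℤ → ℤ) (z : ℤ → ℝ),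
        IsHaggSeq s ∧ (∀ m : ℤ, 39 / 50 * a' ≤ z (m + 1) - z m ∧ z (m + 1) - z m ≤ 17 / 20 * a') ∧
          InHull x (layeredSet a' A s z)

/-- **Certified transfer (sorry-free):** C⁺ and the LANDED theorem `PeriodicGivenLayered_of`
(stmt-11779, all stubs proved) give the crux BY NAME. -/
theorem cleanLimitsHaveWindows_of_layered (h : HullOfCleanLimitIsLayered) :
    Summit.AtomisticToContinuum.Crystallization.Theses.GappedShellCensus.CleanLimitsHaveWindows := by
  intro x hx Y a ha ha1 h0 hlim hclean
  obtain ⟨a', ha', ha'1, A, s, z, hs, hz, hH⟩ := h x hx Y a ha ha1 h0 hlim hclean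
  have hPGL := Summit.AtomisticToContinuum.Crystallization.Theorems.LayeredHull.PeriodicGivenLayered_of
  exact hPGL x hx ⟨a', ha', ha'1, fun R ε hε =>
    (hH R ε hε).mono fun N ⟨t, h1, h2⟩ => ⟨A, t, s, z, hs, hz, h1, h2⟩⟩

/-- **Stub 2 of card A (statement): a UNIFORMLY RECURRENT clean hull element.** Some `Z ∋ 0`, clean
at the same scale, in the hull of `x`, all of whose patches recur with bounded gaps (minimal subset of
the compact translation hull of `Y`; Zorn/Gottschalk, as in the landed `stub_recurrence` for symbolic
data). -/
def RecurrentCleanHullElement : Prop :=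
  ∀ x : (N : ℕ) → (Fin N → E3), (∀ N, IsGroundState lennardJones (x N)) →
    ∀ (Y : Set E3) (a : ℝ), 47 / 50 ≤ a → a ≤ 1 → (0 : E3) ∈ Y → IsLocalLimit x Y → IsClean a Y →
      ∃ Z : Set E3, (0 : E3) ∈ Z ∧ IsClean a Z ∧ InHull x Z ∧
        ∀ r η : ℝ, 0 < η → ∃ L : ℝ, ∀ c : E3, ∀ z₀ ∈ Z, ∃ v ∈ Z, dist v c ≤ L ∧
          (∀ p ∈ Z, dist p z₀ ≤ r → ∃ q ∈ Z, dist (q - v) (p - z₀) ≤ η) ∧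
          (∀ q ∈ Z, dist q v ≤ r → ∃ p ∈ Z, dist (q - v) (p - z₀) ≤ η)

/-! ## Card B — the Palm transfer to `LayeredLawsSelectHcp` (stmt-9226) -/

/-- Point-stationarity in the mass-transport form used verbatim by `LayeredLawsSelectHcp`. -/
def IsPointStationary (P : Measure (Measure E3)) : Prop :=
  ∀ g : Measure E3 → E3 → ENNReal, Measurable (Function.uncurry g) →
    ∫⁻ μ, ∫⁻ y, g μ y ∂μ ∂P = ∫⁻ μ, ∫⁻ y, g (Measure.map (fun z => z - y) μ) (-y) ∂μ ∂P

/-- **First lemma of card `clean-hull-palm`: THE HULL OF A CLEAN LIMIT CARRIES A MINIMISING PALM LAW.**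
Under the crux's hypotheses there is a probability law `P` on counting measures which is a.s.
`count|S` for a `1/3`-hard-core `S ∋ 0` that is CLEAN at scale `a` and lies IN THE HULL OF `x`, is
point-stationary, and is minimising: mean root energy `≤ e* = ⨅ e(Q)`.  (Krylov–Bogolyubov on the
compact translation hull of `Y`, Palm-ised; minimality from the landed window bound (U) for hull sets
and `CrysEnergyLimit`.) -/
def HullPalmLaw : Prop :=
  ∀ x : (N : ℕ) → (Fin N → E3), (∀ N, IsGroundState lennardJones (x N)) →
    ∀ (Y : Set E3) (a : ℝ), 47 / 50 ≤ a → a ≤ 1 → (0 : E3) ∈ Y → IsLocalLimit x Y → IsClean a Y →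
      ∃ P : Measure (Measure E3), IsProbabilityMeasure P ∧
        (∀ᵐ μ ∂P, ∃ S : Set E3, (0 : E3) ∈ S ∧ (∀ p ∈ S, ∀ q ∈ S, p ≠ q → (1 / 3 : ℝ) ≤ dist p q) ∧
          IsClean a S ∧ InHull x S ∧ μ = (Measure.count : Measure E3).restrict S) ∧
        IsPointStationary P ∧
        (∫ μ, (∫ y, lennardJones ‖y‖ ∂μ) / 2 ∂P) ≤
          ⨅ Q : PeriodicConfiguration 3, Q.energyPerParticle lennardJones

/-- **Stub 3 of card B (statement): FUNNEL TO TUBE from 2 %.** A minimising point-stationary law a.s.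
carried by `1/3`-hard-core CLEAN sets (scale `a ∈ [47/50,1]`) is a.s. carried by sets in the tube of
stmt-9226: every point has an `(a_x/100)`-close-packed shell at its own scale `a_x ∈ [9/10, 1]` and the
set is bond-isomorphic to an ideal Barlow stacking (the latter is the chart of stub 1; the former is
the energy step). -/
def FunnelToTubeTwoPercent : Prop :=
  ∀ a : ℝ, 47 / 50 ≤ a → a ≤ 1 → ∀ P : Measure (Measure E3), IsProbabilityMeasure P →
    (∀ᵐ μ ∂P, ∃ S : Set E3, (0 : E3) ∈ S ∧ (∀ p ∈ S, ∀ q ∈ S, p ≠ q → (1 / 3 : ℝ) ≤ dist p q) ∧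
      IsClean a S ∧ μ = (Measure.count : Measure E3).restrict S) →
    IsPointStationary P →
    (∫ μ, (∫ y, lennardJones ‖y‖ ∂μ) / 2 ∂P) ≤ (⨅ Q : PeriodicConfiguration 3, Q.energyPerParticle lennardJones) →
    ∀ᵐ μ ∂P, ∃ S : Set E3, μ = (Measure.count : Measure E3).restrict S ∧
      (∀ p ∈ S, ∃ b : ℝ, 9 / 10 ≤ b ∧ b ≤ 1 ∧ ∃ T : Finset E3,
        (↑T : Set E3) = (fun q : E3 => q - p) '' {q : E3 | q ∈ S ∧ q ≠ p ∧ dist q p ≤ 5 / 4 * b} ∧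
        (ShellCloseTo (b / 100) T (Finset.image (fun v : E3 => b • v) fccKissingPattern) ∨
          ShellCloseTo (b / 100) T (Finset.image (fun v : E3 => b • v) hcpKissingPattern))) ∧
      (∃ s : ℤ → ℤ, IsHaggSeq s ∧ ∃ Φ : E3 → E3, Set.BijOn Φ (barlowStacking 1 (Real.sqrt (2 / 3)) s) S ∧
        ∀ p ∈ barlowStacking 1 (Real.sqrt (2 / 3)) s, ∀ q ∈ barlowStacking 1 (Real.sqrt (2 / 3)) s,
          (dist p q = 1 ↔ (0 < dist (Φ p) (Φ q) ∧ dist (Φ p) (Φ q) ≤ 28 / 25)))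

/-- **Composition of card B (glue sorried, elaborates):** `HullPalmLaw`, `FunnelToTubeTwoPercent` and
the staffed crux `LayeredLawsSelectHcp` (stmt-9226) give the crux: the law's a.s.-exact-hcp conclusion
and its a.s.-in-the-hull support meet in one counting measure, whose carrier `A(hcpStacking a h)` is
the point set of `(hcpPeriodicConfiguration).isometryImage`; its windows are the conclusion. -/
theorem cleanLimitsHaveWindows_of_palm (h₁ : HullPalmLaw) (h₂ : FunnelToTubeTwoPercent)
    (h₃ : Summit.AtomisticToContinuum.Crystallization.Theses.PalmUnimodularRigidity.LayeredLawsSelectHcp) :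
    Summit.AtomisticToContinuum.Crystallization.Theses.GappedShellCensus.CleanLimitsHaveWindows := by
  sorry

end Summit.AtomisticToContinuum.Crystallization.Cruxes.CleanLimitsHaveWindows.IdeatorTwo
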